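import Literature.Analysis.FluidPDE.ConstantinFeffermanStretching
import Literature.Analysis.FluidPDE.RieszHalfPotentialBilinearBound
import HarnessLib

/-!
# The stretching estimate under the ½-Hölder vorticity-direction hypothesis
# (Beirão da Veiga–Berselli 2002; Lemarié-Rieusset 2016, Thm. 11.7)

Analysis/FluidPDE proof file (theorems only: no definition, no named fact, no `sorry`).
Search for candidate a priori estimates; no regularity claim (cell `pub-nsfunc`, literature seat:
this file formalises a PUBLISHED proof; nothing new). It is the analytic heart of the formalisation
of the **½-Hölder direction criterion** — H. Beirão da Veiga, L. C. Berselli, Differential Integral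
Equations 15 (2002) 345–356, Thm. 1.2 with Assumption A at `α = ½` (`g ≡ c`, Remark 1.1:
"`sin θ(x, x+y, t) ≤ c|y|^{1/2}`" in the region where both vorticities exceed `k`); P. G.
Lemarié-Rieusset, *The Navier–Stokes Problem in the 21st Century* (2016), Thm. 11.7 — in the form
of the tree's Constantin–Fefferman brick `exists_two_mul_integral_stretching_le`
(`ConstantinFeffermanStretching.lean`, Lipschitz hypothesis `|sin φ| ≤ |x−y|/ρ`), whose statement and
proof are copied line by line with the direction hypothesis replaced by

  `√(1 − ⟪ξ(x), ξ(y)⟫²) ≤ M |x − y|^{1/2}`  whenever `|ω(x)|, |ω(y)| > Ω`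

(`|ξ(x) ∧ ξ(y)| = |sin φ| = √(1 − ⟪ξ(x), ξ(y)⟫²)` for unit vectors): for `ν, Ω > 0` and any `M`
there are `C₁, …, C₄ ≥ 0` with

  `2 ∫⟪ω, (∇v)ω⟫ ≤ ν ∫|∇ω|²_F + (C₁ + C₂∫|ω|² + C₃∫|v|²) ∫|ω|² + C₄ ∫|∇v|²_F`

for every admissible field `v` (`exists_two_mul_integral_stretching_le_of_holderHalf`) — the
differential inequality of Lemarié-Rieusset's proof (last display of PDF p. 371,
`d/dt ‖ω‖₂²/2 ≤ −(ν/2)‖ω‖²_{Ḣ¹} + … + C'ν⁻¹(R^{2/3}‖ω‖₂^{4/3} + M_R(t)²‖ω‖₂²)‖ω‖₂²`; BdVB (4.11)–(4.12)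
with `p = 3/2`, `b = ∞`) in the Grönwall-ready shape consumed by
`integral_sq_norm_curl_le_of_direction_slab` (`ConstantinFeffermanEnstrophySlab.lean`).

## The one new step

Only the self-stretching of the high vorticity `⟪ω_hi, ∇(K∗ω_hi) ω_hi⟫` changes. The geometric
depletion (`exists_abs_inner_fderiv_biotSavart_le`, `VorticityDirectionDepletion.lean`) with the
Hölder hypothesis gives the pointwise majorant
`|⟪ω_hi(x), ∇(K∗ω_hi)(x) ω_hi(x)⟫| ≤ A M |ω(x)|² ∫ |x−y|^{-5/2} |ω_hi(y)| dy`
(`exists_abs_inner_highPart_fderiv_biotSavart_le_holder`; BdVB (4.6): "`|S₂ω₂·ω₂| ≤ (3/4π)|ω₂|² g I(x)`,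
`I(x) = ∫|ω₂(x+y)| |y|^{α−3} dy`"), and the Riesz-potential form is bounded by the two-radii
inequality `lintegral_mul_rieszHalfPotential_le_two_radii` (`RieszHalfPotentialBilinearBound.lean`)
at the radius `δ = (1 + ‖ω‖₂)⁻¹`, Ladyzhenskaya's interpolation in the form
`∫|ω|⁴ ≤ ‖ω‖₂ ‖ω‖₆³ ≤ ‖ω‖₂ (K‖∇ω‖₂)³` (Cauchy–Schwarz and the Sobolev inequality; BdVB (4.5)) and
Young's inequality with exponents `(4, 4/3)` (`2at³ ≤ εt⁴ + 27a⁴/(16ε³)`), which replaces the print's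
Hardy–Littlewood–Sobolev step `‖ℐ_{1/2}ω‖₃ ≤ C‖ω‖₂` (LR p. 371; BdVB (4.7)) and lands on the same
bound `≲ M ‖ω‖₂² ‖∇ω‖₂`. Constants are explicit but immaterial (non-sharp).

## References

* H. Beirão da Veiga, L. C. Berselli, *On the regularizing effect of the vorticity direction in
  incompressible viscous flows*, Differential Integral Equations 15 (2002) 345–356: Assumption A,
  Remark 1.1, Thm. 1.2, Lemma 4.1 and its proof (4.1)–(4.12). [BeiraodaveigaBerselli2002]
* P. G. Lemarié-Rieusset, *The Navier–Stokes Problem in the 21st Century*, CRC Press (2016),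
  §11.6, Thm. 11.7 and its proof (PDF pp. 369–371). [LemarieRieusset2016]
* P. Constantin, C. Fefferman, Indiana Univ. Math. J. 42 (1993), 775–789, §2 (the Lipschitz
  original). [ConstantinFeffermanIndiana1993]
-/

noncomputable section

open MeasureTheory Set Function Filter Metric Real InnerProductSpace
open _root_.Topology
open scoped ENNReal NNReal RealInnerProductSpace

namespace Literature.Analysis.FluidPDE

-- nested operator types `ℝ³ →L[ℝ] ℝ³ →L[ℝ] ℝ³` (second derivatives)
set_option maxSynthPendingDepth 3

/-! ### The kernel `|x − y|^{-5/2}` against a compactly supported density -/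

/-- `√r · (r³)⁻¹ = r^{-5/2}` for `r > 0`. [folklore] -/
private theorem sqrt_mul_inv_cube {r : ℝ} (hr : 0 < r) :
    Real.sqrt r * (r ^ 3)⁻¹ = r ^ (-(5 / 2 : ℝ)) := by
  rw [Real.sqrt_eq_rpow, ← Real.rpow_natCast, ← Real.rpow_neg hr.le, ← Real.rpow_add hr]
  norm_num

/-- The potential `∫ |x−y|^{-5/2} |h(y)| dy` of a continuous compactly supported `h` converges
absolutely (domination by `sup|h| · 1_{ball}(x−y)|x−y|^{-5/2}`, `5/2 < 3`). [folklore] -/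
private theorem integrable_rieszHalfKernel_mul_norm
    {h : (EuclideanSpace ℝ (Fin 3)) → (EuclideanSpace ℝ (Fin 3))} (hh : Continuous h)
    (hhc : HasCompactSupport h) (x : (EuclideanSpace ℝ (Fin 3))) :
    Integrable fun y => ‖x - y‖ ^ (-(5 / 2 : ℝ)) * ‖h y‖ := by
  obtain ⟨M₀, hM₀⟩ := hh.bounded_above_of_compact_support hhc
  have hM₀0 : 0 ≤ M₀ := (norm_nonneg _).trans (hM₀ x)
  obtain ⟨R₀, hR₀⟩ := hhc.isCompact.isBounded.subset_closedBall (0 : (EuclideanSpace ℝ (Fin 3)))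
  set ρ' : ℝ := |R₀| + ‖x‖ + 1 with hρ'
  have hball : Integrable fun z : (EuclideanSpace ℝ (Fin 3)) =>
      (ball (0 : (EuclideanSpace ℝ (Fin 3))) ρ').indicator (fun z => ‖z‖ ^ (-(5 / 2 : ℝ))) z := by
    rw [integrable_indicator_iff measurableSet_ball]
    exact NewtonPotentialHolder.integrableOn_ball_norm_rpow_neg (by norm_num) ρ'
  have hmaj : Integrable fun y => M₀ *
      (ball (0 : (EuclideanSpace ℝ (Fin 3))) ρ').indicator (fun z => ‖z‖ ^ (-(5 / 2 : ℝ))) (x - y) :=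
    (hball.comp_sub_left x).const_mul _
  have hmeas : AEStronglyMeasurable (fun y => ‖x - y‖ ^ (-(5 / 2 : ℝ)) * ‖h y‖) volume :=
    (((measurable_const.sub measurable_id).norm.pow_const _).mul
      hh.measurable.norm).aestronglyMeasurable
  refine hmaj.mono' hmeas (Eventually.of_forall fun y => ?_)
  have hk0 : 0 ≤ ‖x - y‖ ^ (-(5 / 2 : ℝ)) := Real.rpow_nonneg (norm_nonneg _) _
  rw [Real.norm_of_nonneg (mul_nonneg hk0 (norm_nonneg _))]
  by_cases hy : h y = 0
  · rw [hy, norm_zero, mul_zero]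
    exact mul_nonneg hM₀0 (indicator_nonneg (fun z _ => Real.rpow_nonneg (norm_nonneg _) _) _)
  · have hyR : ‖y‖ ≤ R₀ := mem_closedBall_zero_iff.1 (hR₀ (subset_tsupport _ (mem_support.2 hy)))
    have hxy : ‖x - y‖ < ρ' := by
      calc ‖x - y‖ ≤ ‖x‖ + ‖y‖ := norm_sub_le _ _
        _ < |R₀| + ‖x‖ + 1 := by linarith [le_abs_self R₀]
    have hmem : x - y ∈ ball (0 : (EuclideanSpace ℝ (Fin 3))) ρ' := mem_ball_zero_iff.2 hxy
    rw [indicator_of_mem hmem]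
    calc ‖x - y‖ ^ (-(5 / 2 : ℝ)) * ‖h y‖ ≤ ‖x - y‖ ^ (-(5 / 2 : ℝ)) * M₀ :=
          mul_le_mul_of_nonneg_left (hM₀ y) hk0
      _ = M₀ * ‖x - y‖ ^ (-(5 / 2 : ℝ)) := mul_comm _ _

/-! ### The geometric depletion for the high part under the Hölder hypothesis -/

/-- **Depleted self-stretching of the high vorticity, ½-Hölder form** (Beirão da Veiga–Berselli
2002, (4.6): `|S₂ ω₂ · ω₂| ≤ (3/4π) |ω₂(x)|² g(t,x) I(x)`, `I(x) = ∫ |ω₂(x+y)| |y|^{α−3} dy`, at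
`α = ½`; Lemarié-Rieusset 2016, proof of Thm. 11.7: `|𝒜(t,x,y,x−y)| ≤ C'|y|^{-5/2} M_R(t)`). There is
an absolute `A ≥ 0` such that: for a `C¹` field `w` whose high part `w_hi = (1 − θ_R(w)) w`
(`R > 0`) has compact support, a threshold `Ω ≤ R`, `M ≥ 0`, and the direction hypothesis
`√(1 − ⟪ξ(x), ξ(y)⟫²) ≤ M |x−y|^{1/2}` on `{|w| > Ω}`, one has at every `x`
`|⟪w_hi(x), ∇(K ∗ w_hi)(x) w_hi(x)⟫| ≤ A M |w(x)|² ∫ |x−y|^{-5/2} |w_hi(y)| dy`.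
[cite: BeiraodaveigaBerselli2002, Lemma 4.1 proof (4.6); LemarieRieusset2016, Thm. 11.7 (proof, PDF p. 371)] -/
theorem exists_abs_inner_highPart_fderiv_biotSavart_le_holder :
    ∃ A : ℝ, 0 ≤ A ∧ ∀ ⦃w : (EuclideanSpace ℝ (Fin 3)) → (EuclideanSpace ℝ (Fin 3))⦄
      (_ : ContDiff ℝ 1 w) ⦃R Ω M : ℝ⦄ (_ : 0 < R) (_ : Ω ≤ R) (_ : 0 ≤ M)
      (_ : HasCompactSupport fun y => (1 - radialCutoff R (2 * R) (w y)) • w y)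
      (_ : ∀ x y, Ω < ‖w x‖ → Ω < ‖w y‖ →
        Real.sqrt (1 - ⟪vorticityDirection w x, vorticityDirection w y⟫ ^ 2) ≤
          M * Real.sqrt ‖x - y‖) (x : (EuclideanSpace ℝ (Fin 3))),
      |⟪(1 - radialCutoff R (2 * R) (w x)) • w x,
        fderiv ℝ (biotSavart fun y => (1 - radialCutoff R (2 * R) (w y)) • w y) x
          ((1 - radialCutoff R (2 * R) (w x)) • w x)⟫| ≤
        A * M * ‖w x‖ ^ 2 *
          ∫ y, ‖x - y‖ ^ (-(5 / 2 : ℝ)) * ‖(1 - radialCutoff R (2 * R) (w y)) • w y‖ := by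
  obtain ⟨A, hA0, hdep⟩ := exists_abs_inner_fderiv_biotSavart_le
  refine ⟨A, hA0, ?_⟩
  intro w hw R Ω M hR hΩR hM hhic hdir x
  set hi : (EuclideanSpace ℝ (Fin 3)) → (EuclideanSpace ℝ (Fin 3)) :=
    fun y => (1 - radialCutoff R (2 * R) (w y)) • w y with hhi
  have hhi1 : ContDiff ℝ 1 hi := contDiff_highPart hw R
  have hhicont : Continuous hi := hhi1.continuous
  set P : ℝ := ∫ y, ‖x - y‖ ^ (-(5 / 2 : ℝ)) * ‖hi y‖ with hP
  have hP0 : 0 ≤ P := integral_nonneg fun y =>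
    mul_nonneg (Real.rpow_nonneg (norm_nonneg _) _) (norm_nonneg _)
  by_cases hx : hi x = 0
  · have : (1 - radialCutoff R (2 * R) (w x)) • w x = 0 := hx
    rw [this, inner_zero_left, abs_zero]
    positivity
  -- the direction at `x`
  have hwR : R < ‖w x‖ := lt_norm_of_highPart_ne_zero hR hx
  have hw0 : w x ≠ 0 := by
    intro h; rw [h, norm_zero] at hwR; exact lt_irrefl _ (hR.trans hwR)
  set e : (EuclideanSpace ℝ (Fin 3)) := vorticityDirection w x with he
  have he1 : ‖e‖ = 1 := norm_vorticityDirection w hw0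
  set c : ℝ := (1 - radialCutoff R (2 * R) (w x)) * ‖w x‖ with hc
  have hhix : hi x = c • e := highPart_eq_smul_vorticityDirection w R x
  have hc0 : 0 ≤ c := mul_nonneg (sub_nonneg.2 (radialCutoff_le_one _ _ _)) (norm_nonneg _)
  have hcle : c ≤ ‖w x‖ :=
    mul_le_of_le_one_left (norm_nonneg _) (sub_le_self _ (radialCutoff_nonneg _ _ _))
  -- Hölder continuity of the high part
  obtain ⟨Cl, hCl⟩ := hhi1.lipschitzWith_of_hasCompactSupport hhic one_ne_zero
  have hhol : HolderWith Cl 1 hi := hCl.holderWith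
  -- the depleted majorant
  set g : (EuclideanSpace ℝ (Fin 3)) → ℝ := fun y => A * M * (‖x - y‖ ^ (-(5 / 2 : ℝ)) * ‖hi y‖)
    with hg
  have hgi : Integrable g := (integrable_rieszHalfKernel_mul_norm hhicont hhic x).const_mul (A * M)
  have hdom : ∀ y, y ≠ x → A * ‖hi y - ⟪hi y, e⟫ • e‖ * (‖x - y‖ ^ 3)⁻¹ ≤ g y := by
    intro y hyx
    have hxΩ : Ω < ‖w x‖ := hΩR.trans_lt hwR
    have hr : 0 < ‖x - y‖ := norm_pos_iff.2 (sub_ne_zero.2 (Ne.symm hyx))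
    have hle : ‖hi y - ⟪hi y, e⟫ • e‖ ≤ ‖hi y‖ * min 1 (M * Real.sqrt ‖x - y‖) := by
      refine norm_highPart_sub_inner_smul_le hR he1 fun hyR => ?_
      exact hdir x y hxΩ (hΩR.trans_lt hyR)
    have hle' : ‖hi y - ⟪hi y, e⟫ • e‖ ≤ ‖hi y‖ * (M * Real.sqrt ‖x - y‖) :=
      hle.trans (mul_le_mul_of_nonneg_left (min_le_right _ _) (norm_nonneg _))
    rw [hg]
    calc A * ‖hi y - ⟪hi y, e⟫ • e‖ * (‖x - y‖ ^ 3)⁻¹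
        ≤ A * (‖hi y‖ * (M * Real.sqrt ‖x - y‖)) * (‖x - y‖ ^ 3)⁻¹ := by gcongr
      _ = A * M * ((Real.sqrt ‖x - y‖ * (‖x - y‖ ^ 3)⁻¹) * ‖hi y‖) := by ring
      _ = A * M * (‖x - y‖ ^ (-(5 / 2 : ℝ)) * ‖hi y‖) := by rw [sqrt_mul_inv_cube hr]
  have hkey := hdep one_pos hhol hhic he1 ⟨c, hhix⟩ hgi hdom
  -- assemble
  have hinner : ⟪hi x, fderiv ℝ (biotSavart hi) x (hi x)⟫ =
      c ^ 2 * ⟪e, fderiv ℝ (biotSavart hi) x e⟫ := by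
    rw [hhix, map_smul, real_inner_smul_left, real_inner_smul_right]
    ring
  show |⟪hi x, fderiv ℝ (biotSavart hi) x (hi x)⟫| ≤ A * M * ‖w x‖ ^ 2 * P
  rw [hinner, abs_mul, abs_of_nonneg (sq_nonneg c)]
  have hint_le : ∫ y, g y = A * M * P := by
    rw [hg, integral_const_mul]
  calc c ^ 2 * |⟪e, fderiv ℝ (biotSavart hi) x e⟫| ≤ ‖w x‖ ^ 2 * (A * M * P) :=
        mul_le_mul (pow_le_pow_left₀ hc0 hcle 2) (hkey.trans hint_le.le) (abs_nonneg _)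
          (sq_nonneg _)
    _ = A * M * ‖w x‖ ^ 2 * P := by ring

/-! ### Elementary inequalities -/

/-- Young's inequality with exponents `(4, 4/3)` in polynomial form:
`2 a t³ ≤ ε t⁴ + 27 a⁴/(16 ε³)` for `a, t ≥ 0`, `ε > 0`
(from `t⁴ − 4ut³ + 27u⁴ = (t − 3u)²(t² + 2ut + 3u²) ≥ 0` with `u = a/(2ε)`). [folklore] -/
private theorem two_mul_mul_cube_le {ε a t : ℝ} (hε : 0 < ε) (ha : 0 ≤ a) (ht : 0 ≤ t) :
    2 * a * t ^ 3 ≤ ε * t ^ 4 + 27 * a ^ 4 / (16 * ε ^ 3) := by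
  set u : ℝ := a / (2 * ε) with hu
  have hu0 : 0 ≤ u := by positivity
  have hpoly : 4 * u * t ^ 3 ≤ t ^ 4 + 27 * u ^ 4 := by
    have h : 0 ≤ (t - 3 * u) ^ 2 * (t ^ 2 + 2 * u * t + 3 * u ^ 2) := by positivity
    have hexp : (t - 3 * u) ^ 2 * (t ^ 2 + 2 * u * t + 3 * u ^ 2) =
        t ^ 4 + 27 * u ^ 4 - 4 * u * t ^ 3 := by ring
    rw [hexp] at h
    linarith
  have ha' : a = 2 * ε * u := by rw [hu]; field_simp
  have h1 : 2 * a * t ^ 3 = ε * (4 * u * t ^ 3) := by rw [ha']; ring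
  have h2 : 27 * a ^ 4 / (16 * ε ^ 3) = ε * (27 * u ^ 4) := by
    rw [ha']; field_simp; ring
  rw [h1, h2, ← mul_add]
  exact mul_le_mul_of_nonneg_left hpoly hε.le

/-- **The final count, Hölder form** (Young's inequality twice, `√Y ≤ 1 + Y`): the arithmetic
turning `2T_E ≤ 8ΩF + 8ΩY`, `T_B ≤ 12 c S' √Y √D`, `T_G ≤ A M (c_n √Y t³ + c_f (1 + √Y) √Y Y)` with
`t⁴ = K² D`, and `S'² ≤ 3(64Ω² + C_b²Y + C_v²E)` into
`2(T_E + T_B + T_G) ≤ νD + (C₁ + C₂Y + C₃E)Y + 8ΩF`.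
[cite: LemarieRieusset2016, Thm. 11.7 (proof, final display PDF p. 371); BeiraodaveigaBerselli2002, (4.10)–(4.12)] -/
theorem stretching_count_holder {ν Ω A M cn cf K Cb Cv cθ Y D E F TE TB TG S' t : ℝ}
    (hν : 0 < ν) (hK : 0 < K) (hA : 0 ≤ A) (hM : 0 ≤ M) (hcn : 0 ≤ cn) (hcf : 0 ≤ cf)
    (hY : 0 ≤ Y) (hD : 0 ≤ D) (ht : 0 ≤ t) (ht4 : t ^ 4 = K ^ 2 * D)
    (hTE : 2 * TE ≤ 8 * Ω * F + 8 * Ω * Y)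
    (hTB : TB ≤ 12 * cθ * S' * Real.sqrt Y * Real.sqrt D)
    (hTG : TG ≤ A * M * (cn * Real.sqrt Y * t ^ 3 + cf * ((1 + Real.sqrt Y) * Real.sqrt Y * Y)))
    (hS' : S' ^ 2 ≤ 3 * (64 * Ω ^ 2 + Cb ^ 2 * Y + Cv ^ 2 * E)) :
    2 * (TE + (TB + TG)) ≤
      ν * D + ((8 * Ω + 2 / ν * 144 * cθ ^ 2 * (3 * (64 * Ω ^ 2)) + 2 * A * M * cf) +
        (2 / ν * 144 * cθ ^ 2 * (3 * Cb ^ 2) + 27 * (A * M * cn) ^ 4 * K ^ 6 / (2 * ν ^ 3) +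
          4 * A * M * cf) * Y +
        (2 / ν * 144 * cθ ^ 2 * (3 * Cv ^ 2)) * E) * Y + 8 * Ω * F := by
  set sY : ℝ := Real.sqrt Y with hsY
  set sD : ℝ := Real.sqrt D with hsD
  have hsY0 : 0 ≤ sY := Real.sqrt_nonneg _
  have hsD0 : 0 ≤ sD := Real.sqrt_nonneg _
  have hsY2 : sY ^ 2 = Y := Real.sq_sqrt hY
  have hsD2 : sD ^ 2 = D := Real.sq_sqrt hD
  have hy1 : 2 * (sD * (12 * cθ * S' * sY)) ≤ ν / 2 * sD ^ 2 + 2 / ν * (12 * cθ * S' * sY) ^ 2 :=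
    two_mul_mul_le_add_sq hν _ _
  have hsYle : sY ≤ 1 + Y := by nlinarith [sq_nonneg (sY - 1)]
  -- group `B` (verbatim from `stretching_count`)
  have gB : 2 * TB ≤ ν / 2 * D +
      2 / ν * 144 * cθ ^ 2 * (3 * (64 * Ω ^ 2 + Cb ^ 2 * Y + Cv ^ 2 * E)) * Y := by
    have h1 : 2 * TB ≤ ν / 2 * D + 2 / ν * (144 * cθ ^ 2 * S' ^ 2 * Y) := by
      have h := hy1
      rw [hsD2, show (12 * cθ * S' * sY) ^ 2 = 144 * cθ ^ 2 * S' ^ 2 * sY ^ 2 by ring, hsY2] at h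
      linarith
    have h3 : S' ^ 2 * Y ≤ 3 * (64 * Ω ^ 2 + Cb ^ 2 * Y + Cv ^ 2 * E) * Y :=
      mul_le_mul_of_nonneg_right hS' hY
    have h4 : 0 ≤ 2 / ν * 144 * cθ ^ 2 := by positivity
    have h5 := mul_le_mul_of_nonneg_left h3 h4
    have e1 : 2 / ν * (144 * cθ ^ 2 * S' ^ 2 * Y) = 2 / ν * 144 * cθ ^ 2 * (S' ^ 2 * Y) := by ring
    have e2 : 2 / ν * 144 * cθ ^ 2 * (3 * (64 * Ω ^ 2 + Cb ^ 2 * Y + Cv ^ 2 * E) * Y) =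
        2 / ν * 144 * cθ ^ 2 * (3 * (64 * Ω ^ 2 + Cb ^ 2 * Y + Cv ^ 2 * E)) * Y := by ring
    linarith
  -- group `G`: Young `(4, 4/3)` for the near part, `√Y ≤ 1 + Y` for the far part
  set CG : ℝ := 27 * (A * M * cn) ^ 4 * K ^ 6 / (2 * ν ^ 3) with hCG
  have gG : 2 * TG ≤ ν / 2 * D + CG * Y * Y + 2 * A * M * cf * Y + 4 * A * M * cf * Y * Y := by
    set a : ℝ := A * M * cn * sY with ha
    have ha0 : 0 ≤ a := by positivity
    set ε : ℝ := ν / (2 * K ^ 2) with hε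
    have hε0 : 0 < ε := by positivity
    have hyoung := two_mul_mul_cube_le hε0 ha0 ht
    have hnear : 2 * (A * M * (cn * sY * t ^ 3)) ≤ ν / 2 * D + CG * Y * Y := by
      have e1 : 2 * (A * M * (cn * sY * t ^ 3)) = 2 * a * t ^ 3 := by rw [ha]; ring
      have e2 : ε * t ^ 4 = ν / 2 * D := by
        rw [hε, ht4]; field_simp
      have hsY4 : sY ^ 4 = Y * Y := by
        rw [show (4 : ℕ) = 2 * 2 by norm_num, pow_mul, hsY2, sq]
      have ha4 : a ^ 4 = (A * M * cn) ^ 4 * (Y * Y) := by rw [ha, mul_pow, hsY4]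
      have hε3 : ε ^ 3 = ν ^ 3 / (8 * K ^ 6) := by rw [hε]; ring
      have e3 : 27 * a ^ 4 / (16 * ε ^ 3) = CG * Y * Y := by
        rw [ha4, hε3, hCG]
        field_simp
        ring
      rw [e1, ← e2, ← e3]
      exact hyoung
    have hfar : 2 * (A * M * (cf * ((1 + sY) * sY * Y))) ≤
        2 * A * M * cf * Y + 4 * A * M * cf * Y * Y := by
      have h1 : (1 + sY) * sY ≤ 1 + 2 * Y := by
        have e : (1 + sY) * sY = sY + Y := by rw [← hsY2]; ring
        rw [e]; linarith
      have h2 : (1 + sY) * sY * Y ≤ (1 + 2 * Y) * Y := mul_le_mul_of_nonneg_right h1 hY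
      have h3 : 0 ≤ 2 * A * M * cf := by positivity
      have h4 := mul_le_mul_of_nonneg_left h2 h3
      have e1 : 2 * (A * M * (cf * ((1 + sY) * sY * Y))) =
          2 * A * M * cf * ((1 + sY) * sY * Y) := by ring
      have e2 : 2 * A * M * cf * ((1 + 2 * Y) * Y) =
          2 * A * M * cf * Y + 4 * A * M * cf * Y * Y := by ring
      linarith
    have h0 : 2 * TG ≤ 2 * (A * M * (cn * sY * t ^ 3)) +
        2 * (A * M * (cf * ((1 + sY) * sY * Y))) := by
      have e : A * M * (cn * sY * t ^ 3 + cf * ((1 + sY) * sY * Y)) =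
          A * M * (cn * sY * t ^ 3) + A * M * (cf * ((1 + sY) * sY * Y)) := by ring
      linarith [hTG, e]
    linarith
  have hfin : 2 * (TE + (TB + TG)) ≤ 8 * Ω * F + 8 * Ω * Y +
      (ν / 2 * D + 2 / ν * 144 * cθ ^ 2 * (3 * (64 * Ω ^ 2 + Cb ^ 2 * Y + Cv ^ 2 * E)) * Y) +
      (ν / 2 * D + CG * Y * Y + 2 * A * M * cf * Y + 4 * A * M * cf * Y * Y) := by linarith
  refine hfin.trans (le_of_eq ?_)
  ring

/-! ### The stretching estimate -/

set_option maxHeartbeats 1600000 in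
/-- **The stretching estimate under the ½-Hölder direction hypothesis** (Beirão da Veiga–Berselli
2002, Lemma 4.1, (4.11)–(4.12) at `α = ½`, `p = 3/2`, `b = ∞`; Lemarié-Rieusset 2016, proof of
Thm. 11.7, final differential inequality). For `ν, Ω > 0` and any real `M` there are constants
`C₁, …, C₄ ≥ 0` such that for every divergence-free `v ∈ C²(ℝ³; ℝ³)` with `v, ∇v, ∇²v ∈ L²`, `∇²v`
bounded, and vorticity direction `ξ = ω/|ω|` (`ω = curl v`) satisfying
`√(1 − ⟪ξ(x), ξ(y)⟫²) ≤ M |x − y|^{1/2}` whenever `|ω(x)|, |ω(y)| > Ω`: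
`2 ∫⟪ω, (∇v)ω⟫ ≤ ν ∫|∇ω|²_F + (C₁ + C₂∫|ω|² + C₃∫|v|²) ∫|ω|² + C₄ ∫|∇v|²_F`.
Copy of `exists_two_mul_integral_stretching_le` (smooth high/low splitting, integration by parts with
the sup bound of `LocalHelmholtzSupBound`, geometric depletion) with the self-stretching of the high
part bounded through `lintegral_mul_rieszHalfPotential_le_two_radii` at `δ = (1 + ‖ω‖₂)⁻¹`,
`∫|ω|⁴ ≤ ‖ω‖₂(K‖∇ω‖₂)³` and Young `(4, 4/3)` (module docstring). [cite: BeiraodaveigaBerselli2002, Thm. 1.2 / Lemma 4.1 proof (4.1)–(4.12); LemarieRieusset2016, Thm. 11.7 (proof, PDF pp. 369–371)] -/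
theorem exists_two_mul_integral_stretching_le_of_holderHalf {ν Ω Mh : ℝ} (hν : 0 < ν) (hΩ : 0 < Ω) :
    ∃ C₁ C₂ C₃ C₄ : ℝ, 0 ≤ C₁ ∧ 0 ≤ C₂ ∧ 0 ≤ C₃ ∧ 0 ≤ C₄ ∧
      ∀ ⦃v : (EuclideanSpace ℝ (Fin 3)) → (EuclideanSpace ℝ (Fin 3))⦄ (_ : ContDiff ℝ 2 v)
        (_ : VectorCalculus.IsDivFree v)
        (_ : Integrable fun x => ‖v x‖ ^ 2) (_ : Integrable fun x => ‖fderiv ℝ v x‖ ^ 2)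
        (_ : Integrable fun x => ‖fderiv ℝ (fderiv ℝ v) x‖ ^ 2)
        (_ : ∃ B : ℝ, ∀ x, ‖fderiv ℝ (fderiv ℝ v) x‖ ≤ B)
        (_ : ∀ x y, Ω < ‖curl v x‖ → Ω < ‖curl v y‖ →
          Real.sqrt (1 - ⟪vorticityDirection (curl v) x, vorticityDirection (curl v) y⟫ ^ 2) ≤
            Mh * Real.sqrt ‖x - y‖),
        2 * ∫ x, ⟪curl v x, fderiv ℝ v x (curl v x)⟫ ≤
          ν * (∫ x, frobeniusNormSq (fderiv ℝ (curl v) x)) +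
            (C₁ + C₂ * (∫ x, ‖curl v x‖ ^ 2) + C₃ * (∫ x, ‖v x‖ ^ 2)) * (∫ x, ‖curl v x‖ ^ 2) +
            C₄ * (∫ x, frobeniusNormSq (fderiv ℝ v x)) := by
  -- universal constants
  obtain ⟨A, hA0, hdep⟩ := exists_abs_inner_highPart_fderiv_biotSavart_le_holder
  obtain ⟨Cb, Cv, hCb, hCv, hsup⟩ := exists_norm_sub_biotSavart_le
  obtain ⟨Bθ, hBθ0, hBθ⟩ := exists_norm_fderiv_radialCutoff_le
  set K₀ : ℝ≥0 := SNormLESNormFDerivOfEqConst (EuclideanSpace ℝ (Fin 3)) (volume : Measure (EuclideanSpace ℝ (Fin 3))) 2 with hK₀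
  set K : ℝ := (K₀ : ℝ) + 1 with hK
  have hK0 : 0 < K := by rw [hK]; positivity
  set cθ : ℝ := 1 + 2 * Bθ
  have hcθ0 : 0 ≤ cθ := by positivity
  set v₁ : ℝ := (volume : Measure (EuclideanSpace ℝ (Fin 3))).real (ball 0 1) with hv₁
  have hv₁0 : 0 ≤ v₁ := measureReal_nonneg
  set cn : ℝ := 6 * v₁ with hcn
  have hcn0 : 0 ≤ cn := by positivity
  set cf : ℝ := Real.sqrt (3 * v₁ / 2) with hcf
  have hcf0 : 0 ≤ cf := Real.sqrt_nonneg _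
  set M : ℝ := max Mh 0 with hMdef'
  have hM0 : 0 ≤ M := le_max_right _ _
  have hMhM : Mh ≤ M := le_max_left _ _
  refine ⟨8 * Ω + 2 / ν * 144 * cθ ^ 2 * (3 * (64 * Ω ^ 2)) + 2 * A * M * cf,
    2 / ν * 144 * cθ ^ 2 * (3 * Cb ^ 2) + 27 * (A * M * cn) ^ 4 * K ^ 6 / (2 * ν ^ 3) +
      4 * A * M * cf,
    2 / ν * 144 * cθ ^ 2 * (3 * Cv ^ 2), 8 * Ω, by positivity, by positivity, by positivity,
    by positivity, ?_⟩
  intro v hv hdiv hE hG hH hbd hdir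
  obtain ⟨B, hB⟩ := hbd
  -- ### basic objects
  have hv1 : ContDiff ℝ 1 v := hv.of_le (by norm_num)
  have hvc : Continuous v := hv.continuous
  have hDv : Continuous (fderiv ℝ v) := hv.continuous_fderiv (by norm_num)
  have hω1 : ContDiff ℝ 1 (curl v) := contDiff_curl (n := 1) (by exact hv)
  have hωc : Continuous (curl v) := hω1.continuous
  have hDω : Continuous (fderiv ℝ (curl v)) := hω1.continuous_fderiv one_ne_zero
  have hωle : ∀ x, ‖curl v x‖ ≤ ‖curlCLM‖ * ‖fderiv ℝ v x‖ := fun x => norm_curl_le v x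
  have hDωle : ∀ x, ‖fderiv ℝ (curl v) x‖ ≤ ‖curlCLM‖ * ‖fderiv ℝ (fderiv ℝ v) x‖ := fun x => by
    rw [fderiv_curl hv]
    exact ContinuousLinearMap.opNorm_comp_le _ _
  -- ### integrability
  have Iω : Integrable fun x => ‖curl v x‖ ^ 2 := by
    refine (hG.const_mul (‖curlCLM‖ ^ 2)).mono' ((hωc.norm.pow 2).aestronglyMeasurable)
      (Eventually.of_forall fun x => ?_)
    rw [Real.norm_of_nonneg (sq_nonneg _), ← mul_pow]
    exact pow_le_pow_left₀ (norm_nonneg _) (hωle x) 2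
  have IDω : Integrable fun x => ‖fderiv ℝ (curl v) x‖ ^ 2 := by
    refine (hH.const_mul (‖curlCLM‖ ^ 2)).mono' ((hDω.norm.pow 2).aestronglyMeasurable)
      (Eventually.of_forall fun x => ?_)
    rw [Real.norm_of_nonneg (sq_nonneg _), ← mul_pow]
    exact pow_le_pow_left₀ (norm_nonneg _) (hDωle x) 2
  have Ifv : Integrable fun x => frobeniusNormSq (fderiv ℝ v x) := by
    refine (hG.const_mul 3).mono' (continuous_frobeniusNormSq_fderiv hv (by norm_num)).aestronglyMeasurable
      (Eventually.of_forall fun x => ?_)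
    rw [Real.norm_of_nonneg (frobeniusNormSq_nonneg _)]
    exact frobeniusNormSq_le_three_mul _
  have Ifω : Integrable fun x => frobeniusNormSq (fderiv ℝ (curl v) x) := by
    refine (IDω.const_mul 3).mono' (continuous_frobeniusNormSq_fderiv hω1 one_ne_zero).aestronglyMeasurable
      (Eventually.of_forall fun x => ?_)
    rw [Real.norm_of_nonneg (frobeniusNormSq_nonneg _)]
    exact frobeniusNormSq_le_three_mul _
  -- ### the quantities
  set Y : ℝ := ∫ x, ‖curl v x‖ ^ 2 with hY
  set D : ℝ := ∫ x, frobeniusNormSq (fderiv ℝ (curl v) x) with hD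
  set E : ℝ := ∫ x, ‖v x‖ ^ 2 with hEdef
  set F : ℝ := ∫ x, frobeniusNormSq (fderiv ℝ v x) with hF
  set Dop : ℝ := ∫ x, ‖fderiv ℝ (curl v) x‖ ^ 2 with hDop
  have hY0 : 0 ≤ Y := integral_nonneg fun x => sq_nonneg _
  have hD0 : 0 ≤ D := integral_nonneg fun x => frobeniusNormSq_nonneg _
  have hE0 : 0 ≤ E := integral_nonneg fun x => sq_nonneg _
  have hF0 : 0 ≤ F := integral_nonneg fun x => frobeniusNormSq_nonneg _
  have hDop0 : 0 ≤ Dop := integral_nonneg fun x => sq_nonneg _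
  have hGle : ∫ x, ‖fderiv ℝ v x‖ ^ 2 ≤ F := integral_mono hG Ifv fun x => sq_opNorm_le_frobeniusNormSq _
  have hDopD : Dop ≤ D := integral_mono IDω Ifω fun x => sq_opNorm_le_frobeniusNormSq _
  set sY : ℝ := Real.sqrt Y with hsY
  set sD : ℝ := Real.sqrt D with hsD
  set sE : ℝ := Real.sqrt E with hsE
  have hsY0 : 0 ≤ sY := Real.sqrt_nonneg _
  have hsD0 : 0 ≤ sD := Real.sqrt_nonneg _
  have hsE0 : 0 ≤ sE := Real.sqrt_nonneg _
  have hsY2 : sY ^ 2 = Y := Real.sq_sqrt hY0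
  have hsD2 : sD ^ 2 = D := Real.sq_sqrt hD0
  have hsE2 : sE ^ 2 = E := Real.sq_sqrt hE0
  have hsDop : Real.sqrt Dop ≤ sD := Real.sqrt_le_sqrt hDopD
  -- `L²` norms as square roots
  have hω2 : (eLpNorm (curl v) 2 volume).toReal = sY := toReal_eLpNorm_two_eq_sqrt hωc Iω
  have hv2 : (eLpNorm v 2 volume).toReal = sE := toReal_eLpNorm_two_eq_sqrt hvc hE
  have hDω2 : (eLpNorm (fderiv ℝ (curl v)) 2 volume).toReal = Real.sqrt Dop :=
    toReal_eLpNorm_two_eq_sqrt hDω IDω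
  have hωm2 : MemLp (curl v) 2 volume := (memLp_two_iff_integrable_sq_norm hωc.aestronglyMeasurable).2 Iω
  have hDωm2 : MemLp (fderiv ℝ (curl v)) 2 volume :=
    (memLp_two_iff_integrable_sq_norm hDω.aestronglyMeasurable).2 IDω
  -- Sobolev `‖ω‖₆ ≤ K ‖∇ω‖₂`
  have hsob := eLpNorm_six_le_eLpNorm_fderiv_two (volume : Measure (EuclideanSpace ℝ (Fin 3))) (F := (EuclideanSpace ℝ (Fin 3)))
    finrank_euclideanSpace_fin hω1 hωm2.eLpNorm_lt_top
  -- `‖ω‖₆ ≤ K ‖∇ω‖₂ ≤ K √D` in `ℝ≥0∞` with `K = K₀ + 1 > 0`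
  have hDω_eq : eLpNorm (fderiv ℝ (curl v)) 2 volume = ENNReal.ofReal (Real.sqrt Dop) := by
    rw [← hDω2, ENNReal.ofReal_toReal hDωm2.eLpNorm_lt_top.ne]
  have hK₀K : (K₀ : ℝ≥0∞) ≤ ENNReal.ofReal K := by
    rw [hK, show ((K₀ : ℝ) + 1 : ℝ) = ((K₀ + 1 : ℝ≥0) : ℝ) by push_cast; ring,
      ENNReal.ofReal_coe_nnreal]
    exact_mod_cast le_self_add
  have hω6e : eLpNorm (curl v) 6 volume ≤ ENNReal.ofReal (K * sD) := by
    refine hsob.trans ?_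
    rw [hDω_eq, ENNReal.ofReal_mul hK0.le]
    exact mul_le_mul' hK₀K (ENNReal.ofReal_le_ofReal hsDop)
  -- ### splitting
  set R : ℝ := 2 * Ω with hRdef
  have hR : 0 < R := by positivity
  have hΩR : Ω ≤ R := by linarith
  have hω0 : Tendsto (curl v) (cocompact (EuclideanSpace ℝ (Fin 3))) (𝓝 0) := tendsto_curl_cocompact hv hG hB
  set lo : (EuclideanSpace ℝ (Fin 3)) → (EuclideanSpace ℝ (Fin 3)) := fun y => radialCutoff R (2 * R) (curl v y) • curl v y with hlo
  set hi : (EuclideanSpace ℝ (Fin 3)) → (EuclideanSpace ℝ (Fin 3)) := fun y => (1 - radialCutoff R (2 * R) (curl v y)) • curl v y with hhi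
  have hlohi : ∀ y, curl v y = lo y + hi y := fun y => smul_add_one_sub_smul.symm
  have hlo_le : ∀ y, ‖lo y‖ ≤ 2 * R := fun y => norm_lowPart_le hR y
  have hhi_le : ∀ y, ‖hi y‖ ≤ ‖curl v y‖ := fun y => norm_highPart_le_norm (curl v) R y
  have hhi1 : ContDiff ℝ 1 hi := contDiff_highPart hω1 R
  have hhic : HasCompactSupport hi := hasCompactSupport_highPart hR hω0
  have hhicont : Continuous hi := hhi1.continuous
  have hlocont : Continuous lo := (contDiff_lowPart hω1 R).continuous
  have hDhi_le : ∀ y, ‖fderiv ℝ hi y‖ ≤ cθ * ‖fderiv ℝ (curl v) y‖ := fun y =>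
    norm_fderiv_highPart_le hω1 hBθ0 hBθ hR y
  obtain ⟨Cl, hCl⟩ := hhi1.lipschitzWith_of_hasCompactSupport hhic one_ne_zero
  have hhol : HolderWith Cl 1 hi := hCl.holderWith
  have huhi1 : ContDiff ℝ 1 (biotSavart hi) := contDiff_biotSavart one_pos hhol hhic
  set U : (EuclideanSpace ℝ (Fin 3)) → (EuclideanSpace ℝ (Fin 3)) := fun x => v x - biotSavart hi x with hU
  have hU1 : ContDiff ℝ 1 U := hv1.sub huhi1
  have hDU : ∀ x, fderiv ℝ U x = fderiv ℝ v x - fderiv ℝ (biotSavart hi) x := fun x =>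
    fderiv_fun_sub ((hv1.differentiable one_ne_zero) x) ((huhi1.differentiable one_ne_zero) x)
  -- ### the sup bound for `U`
  have hvl2 : ∫⁻ y, ‖v y‖ₑ ^ 2 < ⊤ := lintegral_enorm_sq_lt_top_of_integrable_sq hE
  have hhi2 : (eLpNorm hi 2 volume).toReal ≤ sY := by
    rw [← hω2]
    refine ENNReal.toReal_mono hωm2.eLpNorm_lt_top.ne (eLpNorm_mono fun y => hhi_le y)
  set S : ℝ := 2 * (2 * R) + Cb * (eLpNorm hi 2 volume).toReal + Cv * (eLpNorm v 2 volume).toReal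
    with hSdef
  have hS : ∀ x, ‖U x‖ ≤ S := fun x => hsup hv hdiv hvl2 hlohi hlo_le hhicont hhic x
  set S' : ℝ := 8 * Ω + Cb * sY + Cv * sE with hS'
  have hSS' : S ≤ S' := by
    have h1 := mul_le_mul_of_nonneg_left hhi2 hCb
    simp only [hSdef, hS']
    rw [hv2]
    linarith [h1, hRdef]
  have hS0 : 0 ≤ S := (norm_nonneg _).trans (hS 0)
  -- ### the depletion inputs (Hölder form)
  have hPint : ∀ x, Integrable fun y => ‖x - y‖ ^ (-(5 / 2 : ℝ)) * ‖hi y‖ :=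
    fun x => integrable_rieszHalfKernel_mul_norm hhicont hhic x
  have hdir' : ∀ x y, Ω < ‖curl v x‖ → Ω < ‖curl v y‖ →
      Real.sqrt (1 - ⟪vorticityDirection (curl v) x, vorticityDirection (curl v) y⟫ ^ 2) ≤
        M * Real.sqrt ‖x - y‖ := fun x y hx hy =>
    (hdir x y hx hy).trans (mul_le_mul_of_nonneg_right hMhM (Real.sqrt_nonneg _))
  -- pointwise depletion bound
  have hGpt : ∀ x, |⟪hi x, fderiv ℝ (biotSavart hi) x (hi x)⟫| ≤
      A * M * ‖curl v x‖ ^ 2 * ∫ y, ‖x - y‖ ^ (-(5 / 2 : ℝ)) * ‖hi y‖ :=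
    fun x => hdep hω1 hR hΩR hM0 hhic hdir' x
  -- ### the pointwise decomposition of the stretching density
  set Et : (EuclideanSpace ℝ (Fin 3)) → ℝ := fun x => ⟪lo x, fderiv ℝ v x (curl v x)⟫ + ⟪hi x, fderiv ℝ v x (lo x)⟫ with hEt
  set Bt : (EuclideanSpace ℝ (Fin 3)) → ℝ := fun x => ⟪hi x, fderiv ℝ U x (hi x)⟫ with hBt
  set Gt : (EuclideanSpace ℝ (Fin 3)) → ℝ := fun x => ⟪hi x, fderiv ℝ (biotSavart hi) x (hi x)⟫ with hGt
  have hsplit : ∀ x, ⟪curl v x, fderiv ℝ v x (curl v x)⟫ = Et x + (Bt x + Gt x) := by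
    intro x
    have hω' := hlohi x
    have h1 : Bt x + Gt x = ⟪hi x, fderiv ℝ v x (hi x)⟫ := by
      show ⟪hi x, fderiv ℝ U x (hi x)⟫ + ⟪hi x, fderiv ℝ (biotSavart hi) x (hi x)⟫ = _
      rw [← inner_add_right, hDU x, sub_apply, sub_add_cancel]
    rw [h1]
    show ⟪curl v x, fderiv ℝ v x (curl v x)⟫ =
      (⟪lo x, fderiv ℝ v x (curl v x)⟫ + ⟪hi x, fderiv ℝ v x (lo x)⟫) + ⟪hi x, fderiv ℝ v x (hi x)⟫
    rw [hω']
    simp only [map_add, inner_add_left, inner_add_right]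
    ring
  -- integrability of the three pieces
  have hEt_pt : ∀ x, |Et x| ≤ 2 * R * (‖fderiv ℝ v x‖ ^ 2 + ‖curl v x‖ ^ 2) := fun x =>
    abs_inner_low_terms_le (fderiv ℝ v x) (by positivity) (hlo_le x) (hhi_le x)
  have Idom : Integrable fun x => 2 * R * (‖fderiv ℝ v x‖ ^ 2 + ‖curl v x‖ ^ 2) := by
    have h := (hG.add IDω).const_mul (2 * R)
    have h' := (hG.add Iω).const_mul (2 * R)
    exact h'
  have IEt : Integrable Et := by
    have hcont : Continuous Et :=
      ((hlocont.inner (hDv.clm_apply hωc))).add (hhicont.inner (hDv.clm_apply hlocont))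
    refine Idom.mono' hcont.aestronglyMeasurable (Eventually.of_forall fun x => ?_)
    rw [Real.norm_eq_abs]
    exact hEt_pt x
  have hsupp_inner : ∀ (L : (EuclideanSpace ℝ (Fin 3)) → (EuclideanSpace ℝ (Fin 3)) →L[ℝ] (EuclideanSpace ℝ (Fin 3))), Continuous L →
      Integrable fun x => ⟪hi x, L x (hi x)⟫ := by
    intro L hL
    refine (hhicont.inner (hL.clm_apply hhicont)).integrable_of_hasCompactSupport ?_
    refine hhic.mono fun x hx => ?_
    rw [mem_support] at hx ⊢
    intro h
    exact hx (by rw [h, inner_zero_left])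
  have IBt : Integrable Bt := hsupp_inner _ (hU1.continuous_fderiv one_ne_zero)
  have IGt : Integrable Gt := hsupp_inner _ (huhi1.continuous_fderiv one_ne_zero)
  have IBG : Integrable fun x => Bt x + Gt x := IBt.add IGt
  have hP : ∫ x, ⟪curl v x, fderiv ℝ v x (curl v x)⟫ = (∫ x, Et x) + ((∫ x, Bt x) + ∫ x, Gt x) := by
    rw [← integral_add IBt IGt, ← integral_add IEt IBG]
    exact integral_congr_ae (Eventually.of_forall hsplit)
  -- ### bound of the low terms
  have hTE : ∫ x, Et x ≤ 2 * R * (F + Y) := by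
    have h1 : ∫ x, Et x ≤ ∫ x, 2 * R * (‖fderiv ℝ v x‖ ^ 2 + ‖curl v x‖ ^ 2) :=
      integral_mono IEt Idom fun x => (le_abs_self _).trans (hEt_pt x)
    refine h1.trans ?_
    rw [integral_const_mul, integral_add hG Iω]
    exact mul_le_mul_of_nonneg_left (add_le_add hGle le_rfl) (by positivity)
  -- ### bound of the `u_lo` term by integration by parts
  have Idom2 : Integrable fun x => (‖curl v x‖ ^ 2 + ‖fderiv ℝ (curl v) x‖ ^ 2) / 2 := by
    have h := (Iω.add IDω).div_const 2
    exact h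
  have IωDω : Integrable fun x => ‖curl v x‖ * ‖fderiv ℝ (curl v) x‖ := by
    refine Idom2.mono' (hωc.norm.mul hDω.norm).aestronglyMeasurable
      (Eventually.of_forall fun x => ?_)
    rw [Real.norm_of_nonneg (mul_nonneg (norm_nonneg _) (norm_nonneg _))]
    nlinarith [sq_nonneg (‖curl v x‖ - ‖fderiv ℝ (curl v) x‖)]
  have hTB : ∫ x, Bt x ≤ 12 * cθ * S' * sY * sD := by
    have h1 : |∫ x, Bt x| ≤ 12 * S * ∫ x, ‖hi x‖ * ‖fderiv ℝ hi x‖ :=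
      abs_integral_inner_fderiv_apply_le_of_hasCompactSupport hhi1 hhic hU1 hS
    have h2 : ∫ x, ‖hi x‖ * ‖fderiv ℝ hi x‖ ≤ cθ * ∫ x, ‖curl v x‖ * ‖fderiv ℝ (curl v) x‖ := by
      rw [← integral_const_mul]
      refine integral_mono ((hhicont.norm.mul (hhi1.continuous_fderiv one_ne_zero).norm).integrable_of_hasCompactSupport
        (hhic.norm.mul_right)) (IωDω.const_mul cθ) fun x => ?_
      show ‖hi x‖ * ‖fderiv ℝ hi x‖ ≤ cθ * (‖curl v x‖ * ‖fderiv ℝ (curl v) x‖)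
      calc ‖hi x‖ * ‖fderiv ℝ hi x‖ ≤ ‖curl v x‖ * (cθ * ‖fderiv ℝ (curl v) x‖) :=
            mul_le_mul (hhi_le x) (hDhi_le x) (norm_nonneg _) (norm_nonneg _)
        _ = cθ * (‖curl v x‖ * ‖fderiv ℝ (curl v) x‖) := by ring
    have h3 : ∫ x, ‖curl v x‖ * ‖fderiv ℝ (curl v) x‖ ≤ sY * sD :=
      (integral_norm_mul_norm_le_sqrt hωc hDω Iω IDω).trans
        (mul_le_mul_of_nonneg_left hsDop hsY0)
    have h4 : 0 ≤ ∫ x, ‖hi x‖ * ‖fderiv ℝ hi x‖ := integral_nonneg fun x => by positivity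
    calc ∫ x, Bt x ≤ |∫ x, Bt x| := le_abs_self _
      _ ≤ 12 * S * ∫ x, ‖hi x‖ * ‖fderiv ℝ hi x‖ := h1
      _ ≤ 12 * S' * (cθ * (sY * sD)) := by
          refine mul_le_mul (mul_le_mul_of_nonneg_left hSS' (by norm_num)) (h2.trans ?_) h4 (by positivity)
          exact mul_le_mul_of_nonneg_left h3 hcθ0
      _ = 12 * cθ * S' * sY * sD := by ring
  -- ### bound of the `u_hi` term: depletion, two-radii Riesz bound, Ladyzhenskaya
  set t : ℝ := Real.sqrt (K * sD) with htdef
  have ht0 : 0 ≤ t := Real.sqrt_nonneg _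
  have hKsD : 0 ≤ K * sD := mul_nonneg hK0.le hsD0
  have ht2 : t ^ 2 = K * sD := Real.sq_sqrt hKsD
  have ht4 : t ^ 4 = K ^ 2 * D := by
    rw [show (4 : ℕ) = 2 * 2 by norm_num, pow_mul, ht2, mul_pow, hsD2]
  have hTG : ∫ x, Gt x ≤ A * M * (cn * sY * t ^ 3 + cf * ((1 + sY) * sY * Y)) := by
    -- (i) `∫ G ≤ ∫ |G| = (∫⁻ ‖G‖ₑ).toReal`
    have h1 : ∫ x, Gt x ≤ ∫ x, ‖Gt x‖ := integral_mono IGt IGt.norm fun x => le_abs_self _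
    rw [integral_norm_eq_lintegral_enorm IGt.aestronglyMeasurable] at h1
    -- (ii) the `ℝ≥0∞` objects
    set Φ : (EuclideanSpace ℝ (Fin 3)) → ℝ≥0∞ := fun x => ‖curl v x‖ₑ ^ 2 with hΦ
    set Fh : (EuclideanSpace ℝ (Fin 3)) → ℝ≥0∞ := fun y => ‖hi y‖ₑ with hFh
    have hΦm : Measurable Φ := hωc.measurable.enorm.pow_const 2
    have hFm : Measurable Fh := hhicont.measurable.enorm
    set Pe : (EuclideanSpace ℝ (Fin 3)) → ℝ≥0∞ := fun x =>
      ∫⁻ y, Fh y * ENNReal.ofReal (‖x - y‖ ^ (-(5 / 2 : ℝ))) with hPe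
    -- `ofReal` of the real potential is the `ℝ≥0∞` potential
    have hPeq : ∀ x, ENNReal.ofReal (∫ y, ‖x - y‖ ^ (-(5 / 2 : ℝ)) * ‖hi y‖) = Pe x := by
      intro x
      rw [ofReal_integral_eq_lintegral_ofReal (hPint x) (Eventually.of_forall fun y =>
        mul_nonneg (Real.rpow_nonneg (norm_nonneg _) _) (norm_nonneg _))]
      refine lintegral_congr fun y => ?_
      rw [ENNReal.ofReal_mul (Real.rpow_nonneg (norm_nonneg _) _), ofReal_norm, mul_comm]
    -- pointwise: `‖G(x)‖ₑ ≤ ofReal(A M) Φ(x) Pe(x)`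
    have hpt : ∀ x, ‖Gt x‖ₑ ≤ ENNReal.ofReal (A * M) * (Φ x * Pe x) := by
      intro x
      rw [Real.enorm_eq_ofReal_abs]
      refine (ENNReal.ofReal_le_ofReal (hGpt x)).trans (le_of_eq ?_)
      rw [ENNReal.ofReal_mul (by positivity : 0 ≤ A * M * ‖curl v x‖ ^ 2),
        ENNReal.ofReal_mul (by positivity : 0 ≤ A * M), hPeq x, hΦ]
      simp only
      rw [ENNReal.ofReal_pow (norm_nonneg _), ofReal_norm, mul_assoc]
    have h2 : ∫⁻ x, ‖Gt x‖ₑ ≤ ENNReal.ofReal (A * M) * ∫⁻ x, Φ x * Pe x := by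
      calc ∫⁻ x, ‖Gt x‖ₑ ≤ ∫⁻ x, ENNReal.ofReal (A * M) * (Φ x * Pe x) := lintegral_mono hpt
        _ = ENNReal.ofReal (A * M) * ∫⁻ x, Φ x * Pe x :=
            lintegral_const_mul' _ _ ENNReal.ofReal_ne_top
    -- (iii) the two-radii bound at `δ = (1 + √Y)⁻¹`
    set δ : ℝ := (1 + sY)⁻¹ with hδ
    have hδ0 : 0 < δ := by rw [hδ]; positivity
    have h3 := lintegral_mul_rieszHalfPotential_le_two_radii hΦm hFm hδ0
    -- (iv) the sizes: `∫Φ = Y`, `∫F² ≤ Y`, `∫Φ² ≤ √Y (K√D)³`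
    have hΦ1 : ∫⁻ x, Φ x = ENNReal.ofReal Y := by
      rw [hY, ofReal_integral_eq_lintegral_ofReal Iω (Eventually.of_forall fun x => sq_nonneg _)]
      refine lintegral_congr fun x => ?_
      rw [hΦ]; simp only
      rw [ENNReal.ofReal_pow (norm_nonneg _), ofReal_norm]
    have hF2 : ∫⁻ y, Fh y ^ 2 ≤ ENNReal.ofReal Y := by
      rw [← hΦ1]
      refine lintegral_mono fun y => ?_
      rw [hFh, hΦ]; simp only
      rw [← ofReal_norm, ← ofReal_norm]
      exact pow_le_pow_left' (ENNReal.ofReal_le_ofReal (hhi_le y)) 2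
    have hF2r : (∫⁻ y, Fh y ^ 2) ^ (1 / 2 : ℝ) ≤ ENNReal.ofReal sY := by
      refine (ENNReal.rpow_le_rpow hF2 (by norm_num)).trans (le_of_eq ?_)
      rw [ENNReal.ofReal_rpow_of_nonneg hY0 (by norm_num), hsY, Real.sqrt_eq_rpow]
    have hΦ2 : ∫⁻ x, Φ x ^ 2 ≤ ENNReal.ofReal (sY * (K * sD) ^ 3) := by
      -- Cauchy–Schwarz `∫|ω|⁴ ≤ (∫|ω|²)^{1/2} (∫|ω|⁶)^{1/2}` and Sobolev `‖ω‖₆ ≤ K√D`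
      have hcs := ENNReal.lintegral_mul_le_Lp_mul_Lq volume Real.HolderConjugate.two_two
        (hωc.measurable.enorm).aemeasurable ((hωc.measurable.enorm).pow_const 3).aemeasurable
      simp only [Pi.mul_apply] at hcs
      have e2 : ∀ (G : (EuclideanSpace ℝ (Fin 3)) → ℝ≥0∞), ∫⁻ x, G x ^ (2 : ℝ) = ∫⁻ x, G x ^ 2 :=
        fun G => lintegral_congr fun x => by
          rw [show (2 : ℝ) = ((2 : ℕ) : ℝ) by norm_num, ENNReal.rpow_natCast]
      rw [e2, e2] at hcs
      have hlhs : ∫⁻ x, Φ x ^ 2 = ∫⁻ x, ‖curl v x‖ₑ * ‖curl v x‖ₑ ^ 3 :=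
        lintegral_congr fun x => by rw [hΦ]; simp only; ring
      have hY2 : (∫⁻ x, ‖curl v x‖ₑ ^ 2) ^ (1 / (2 : ℝ)) = ENNReal.ofReal sY := by
        have : ∫⁻ x, ‖curl v x‖ₑ ^ 2 = ENNReal.ofReal Y := hΦ1
        rw [this, ENNReal.ofReal_rpow_of_nonneg hY0 (by norm_num), hsY, Real.sqrt_eq_rpow]
      have h6 : ∫⁻ x, (‖curl v x‖ₑ ^ 3) ^ 2 ≤ ENNReal.ofReal (K * sD) ^ (6 : ℝ) := by
        have hrepr := eLpNorm_eq_lintegral_rpow_enorm_toReal (μ := volume) (f := curl v)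
          (by norm_num : (6 : ℝ≥0∞) ≠ 0) (by norm_num : (6 : ℝ≥0∞) ≠ ⊤)
        have h6r : (6 : ℝ≥0∞).toReal = 6 := by norm_num
        rw [h6r] at hrepr
        have hI : ∫⁻ x, ‖curl v x‖ₑ ^ (6 : ℝ) = eLpNorm (curl v) 6 volume ^ (6 : ℝ) := by
          rw [hrepr, ← ENNReal.rpow_mul]; norm_num
        have hpt6 : ∀ x, (‖curl v x‖ₑ ^ 3) ^ 2 = ‖curl v x‖ₑ ^ (6 : ℝ) := fun x => by
          rw [← pow_mul, show (6 : ℝ) = ((6 : ℕ) : ℝ) by norm_num, ENNReal.rpow_natCast]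
        simp_rw [hpt6]
        rw [hI]
        exact ENNReal.rpow_le_rpow hω6e (by norm_num)
      have h6r : (∫⁻ x, (‖curl v x‖ₑ ^ 3) ^ 2) ^ (1 / (2 : ℝ)) ≤ ENNReal.ofReal ((K * sD) ^ 3) := by
        refine (ENNReal.rpow_le_rpow h6 (by norm_num)).trans (le_of_eq ?_)
        rw [← ENNReal.rpow_mul, show (6 : ℝ) * (1 / 2) = ((3 : ℕ) : ℝ) by norm_num,
          ENNReal.rpow_natCast, ENNReal.ofReal_pow hKsD]
      rw [hlhs]
      calc ∫⁻ x, ‖curl v x‖ₑ * ‖curl v x‖ₑ ^ 3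
          ≤ (∫⁻ x, ‖curl v x‖ₑ ^ 2) ^ (1 / (2 : ℝ)) * (∫⁻ x, (‖curl v x‖ₑ ^ 3) ^ 2) ^ (1 / (2 : ℝ)) := hcs
        _ ≤ ENNReal.ofReal sY * ENNReal.ofReal ((K * sD) ^ 3) := by
            rw [hY2]; exact mul_le_mul_right h6r _
        _ = ENNReal.ofReal (sY * (K * sD) ^ 3) := (ENNReal.ofReal_mul hsY0).symm
    have hΦ2r : (∫⁻ x, Φ x ^ 2) ^ (1 / 2 : ℝ) ≤ ENNReal.ofReal (Real.sqrt (sY * (K * sD) ^ 3)) := by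
      refine (ENNReal.rpow_le_rpow hΦ2 (by norm_num)).trans (le_of_eq ?_)
      rw [ENNReal.ofReal_rpow_of_nonneg (by positivity) (by norm_num), Real.sqrt_eq_rpow]
    -- (v) assemble in `ℝ≥0∞`, then pass to `ℝ`
    set W : ℝ := cn * Real.sqrt δ * (Real.sqrt (sY * (K * sD) ^ 3) * sY) + cf / δ * sY * Y with hW
    have hW0 : 0 ≤ W := by positivity
    have h4 : ∫⁻ x, Φ x * Pe x ≤ ENNReal.ofReal W := by
      refine h3.trans ?_
      have ha : ENNReal.ofReal (6 * v₁ * Real.sqrt δ) *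
          ((∫⁻ x, Φ x ^ 2) ^ (1 / 2 : ℝ) * (∫⁻ y, Fh y ^ 2) ^ (1 / 2 : ℝ)) ≤
          ENNReal.ofReal (cn * Real.sqrt δ * (Real.sqrt (sY * (K * sD) ^ 3) * sY)) := by
        rw [ENNReal.ofReal_mul (by positivity : 0 ≤ cn * Real.sqrt δ),
          ENNReal.ofReal_mul (Real.sqrt_nonneg _), hcn]
        exact mul_le_mul_right (mul_le_mul' hΦ2r hF2r) _
      have hb : ENNReal.ofReal (Real.sqrt (3 * v₁ / 2) / δ) * (∫⁻ y, Fh y ^ 2) ^ (1 / 2 : ℝ) *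
          (∫⁻ x, Φ x) ≤ ENNReal.ofReal (cf / δ * sY * Y) := by
        rw [hΦ1, ENNReal.ofReal_mul (by positivity : 0 ≤ cf / δ * sY),
          ENNReal.ofReal_mul (by positivity : 0 ≤ cf / δ), hcf]
        exact mul_le_mul_left (mul_le_mul_right hF2r _) _
      calc _ ≤ ENNReal.ofReal (cn * Real.sqrt δ * (Real.sqrt (sY * (K * sD) ^ 3) * sY)) +
            ENNReal.ofReal (cf / δ * sY * Y) := add_le_add ha hb
        _ = ENNReal.ofReal W := by rw [hW, ENNReal.ofReal_add (by positivity) (by positivity)]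
    have h5 : (∫⁻ x, ‖Gt x‖ₑ).toReal ≤ A * M * W := by
      have h := h2.trans (mul_le_mul_right h4 _)
      rw [← ENNReal.ofReal_mul (by positivity)] at h
      have h' := ENNReal.toReal_mono ENNReal.ofReal_ne_top h
      rwa [ENNReal.toReal_ofReal (by positivity)] at h'
    -- (vi) the choice of `δ`: `√δ √(√Y (K√D)³) ≤ t³`, `cf/δ = cf (1 + √Y)`
    have hWle : W ≤ cn * sY * t ^ 3 + cf * ((1 + sY) * sY * Y) := by
      have hsq : Real.sqrt δ * Real.sqrt (sY * (K * sD) ^ 3) ≤ t ^ 3 := by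
        rw [← Real.sqrt_mul hδ0.le]
        have hle : δ * (sY * (K * sD) ^ 3) ≤ (K * sD) ^ 3 := by
          have hfrac : δ * sY ≤ 1 := by
            rw [hδ, inv_mul_le_iff₀ (by positivity : (0 : ℝ) < 1 + sY)]
            linarith
          calc δ * (sY * (K * sD) ^ 3) = (δ * sY) * (K * sD) ^ 3 := by ring
            _ ≤ 1 * (K * sD) ^ 3 := mul_le_mul_of_nonneg_right hfrac (by positivity)
            _ = (K * sD) ^ 3 := one_mul _
        calc Real.sqrt (δ * (sY * (K * sD) ^ 3)) ≤ Real.sqrt ((K * sD) ^ 3) := Real.sqrt_le_sqrt hle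
          _ = t ^ 3 := by
              rw [htdef, show (K * sD) ^ 3 = (K * sD) ^ 2 * (K * sD) by ring,
                Real.sqrt_mul (by positivity), Real.sqrt_sq hKsD]
              rw [show Real.sqrt (K * sD) ^ 3 = Real.sqrt (K * sD) ^ 2 * Real.sqrt (K * sD) by ring,
                Real.sq_sqrt hKsD]
      have hδinv : cf / δ = cf * (1 + sY) := by
        rw [hδ, div_inv_eq_mul]
      rw [hW, hδinv]
      have : cn * Real.sqrt δ * (Real.sqrt (sY * (K * sD) ^ 3) * sY) =
          cn * sY * (Real.sqrt δ * Real.sqrt (sY * (K * sD) ^ 3)) := by ring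
      rw [this]
      have h := mul_le_mul_of_nonneg_left hsq (by positivity : 0 ≤ cn * sY)
      linarith
    calc ∫ x, Gt x ≤ (∫⁻ x, ‖Gt x‖ₑ).toReal := h1
      _ ≤ A * M * W := h5
      _ ≤ A * M * (cn * sY * t ^ 3 + cf * ((1 + sY) * sY * Y)) :=
          mul_le_mul_of_nonneg_left hWle (by positivity)
  -- ### the final count
  have hS'0 : 0 ≤ S' := hS0.trans hSS'
  have hS'sq : S' ^ 2 ≤ 3 * (64 * Ω ^ 2 + Cb ^ 2 * Y + Cv ^ 2 * E) := by
    have h : S' ^ 2 ≤ 3 * ((8 * Ω) ^ 2 + (Cb * sY) ^ 2 + (Cv * sE) ^ 2) := by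
      rw [hS']
      nlinarith [sq_nonneg (8 * Ω - Cb * sY), sq_nonneg (Cb * sY - Cv * sE), sq_nonneg (8 * Ω - Cv * sE)]
    calc S' ^ 2 ≤ 3 * ((8 * Ω) ^ 2 + (Cb * sY) ^ 2 + (Cv * sE) ^ 2) := h
      _ = 3 * (64 * Ω ^ 2 + Cb ^ 2 * Y + Cv ^ 2 * E) := by
          simp only [mul_pow, hsY2, hsE2]; ring
  have gE : 2 * ∫ x, Et x ≤ 8 * Ω * F + 8 * Ω * Y := by
    have e : 2 * (2 * R * (F + Y)) = 8 * Ω * F + 8 * Ω * Y := by rw [hRdef]; ring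
    linarith [hTE]
  rw [hP]
  exact stretching_count_holder hν hK0 hA0 hM0 hcn0 hcf0 hY0 hD0 ht0 ht4 gE hTB hTG hS'sq

end Literature.Analysis.FluidPDE

end
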